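import Mathlib
import HarnessLib
import Summits.HubbardSuperconductivity.HubbardSuperconductivity.Theorems.KLProgrammeKLRegimeEngineReadingJetFunctional
import Summits.HubbardSuperconductivity.HubbardSuperconductivity.Theorems.KLProgrammeKLRegimeEngineFrameShiftMomentResponseCT

/-!
# K3 gen-8-FLOW (stmt 20437 `KLRegimeEngineV17F2`, stub (C), located risk «(C)-B-REP», design B-CT p2 g13 §2): the PER-FUNCTIONAL covariance-response
# door for the READING JETS — loop channel by position moments (entry sum × four-leg moments over the SUPPORT of `ṡ`), tree channel abstracted

Cell gate-hubbard-kl, seat p2 g13 (memo `B-CT-DESIGN-p2g13.md`, evidence on 20437).  Setting of p559571/p561071 (`𝒲′[s] = effAction (normalCovariance s) (V_U + 𝒩_K)`,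
Polchinski interpolation `s_t = s₀ + t(s₁ − s₀)`, F1 `Literature.….norm_apply_effAction_sub_le_of_linePath`), but the fixed `ℂ`-linear functional is now the
complexified READING JET `Φ_{j,q,v}(W) = Λ_{j,q,v}(k ↦ ¼Σ_σ[Σ[W]((ω₊,k),σ) + Σ[W]((ω₋,k),σ)])` of `…EngineReadingJetFunctional` (its real part is the `j`-th momentum
derivative at `q` in directions `v` of the symmetrised interpolant of the spin/frequency-averaged real part — the currency of `klLocSelfEnergyRe`/`klLocalPart`),
and the two terms of its `t`-derivative are bounded SEPARATELY:

* LOOP (`Φ(Δ_{ṡ}𝒲_t)`): by the pure position moments — `covResp_moment_kernel_two_laplacian_le_of_support` (p536707's loop bound with the four-leg hypothesis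
  asked only for loop labels `A` in the SUPPORT of `ṡ = s₁ − s₀`; for the mismatch-resummed defect of `…TwoVolumeFrameMismatchResum` that support is the scale-`n`
  shell), `sum_momentWeight_norm_torusFourierInv_selfEnergy_laplacian_le` (`×2|β|L²`), so `‖Φ(Δ𝒲_t)‖ ≤ 2·2|β|L²·12·(Σ_p‖ṡ p‖)·N_j·∏‖vᵢ‖`;
* TREE (`½Φ((𝒲_t,𝒲_t)_{ṡ})`): ABSTRACTED as jet bounds `A` of the interpolated real and imaginary parts of the tree data
  `k ↦ ¼Σ_σ[Σ[(𝒲_t,𝒲_t)_{ṡ}]((ω₊,k),σ) + Σ[(𝒲_t,𝒲_t)_{ṡ}]((ω₋,k),σ)]` AT THE POINT `q` (to be discharged by the sup/aliasing route on the below-shell region,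
  where this data vanishes identically — memo §3; in the moment currency it is scale-limited, memo (F3));

giving **`covRespCT_readingJet_sub_le`**:
`‖Dʲ[evalM (symInterp L (¼Σ_σ[Re Σ[𝒲′[s₁]](ω_±,·,σ)] − ¼Σ_σ[Re Σ[𝒲′[s₀]](ω_±,·,σ)]))](q)‖ ≤ 4|β|L²·12·(Σ_p‖(s₁−s₀) p‖)·N_j + A_re + A_im`.
Proofs only; nothing about `N_j`, `A`, `Z_t` or the sizes of `𝒲` is asserted; nothing asserts superconductivity.  References: Salmhofer 1998 §3.1 Prop. 1; BGM 2006 §2.3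
(2.17), §3 (3.3) [cite: BenfattoGiulianiMastropietro2006]; FST 1996 §1.
-/

noncomputable section

namespace Summit.HubbardSuperconductivity.HubbardSuperconductivity.Theorems.EngineV8

set_option linter.dupNamespace false -- summit = problem name (single-conjunct summit), D-0017

open Finset Literature.MathematicalPhysics.QuantumLattice Literature.Probability.LatticeModels GrassmannAlgebra
open Summit.HubbardSuperconductivity.HubbardSuperconductivity.Theorems.KLRegimeSplit
open Summit.HubbardSuperconductivity.HubbardSuperconductivity.Theorems.TwoVolumeDefect

variable {L M : ℕ} [NeZero L]

/-! ## §1 Linearity of the self-energy reading in the Grassmann element -/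

omit [NeZero L] in
/-- `Σ[F + G] = Σ[F] + Σ[G]`. -/
theorem selfEnergy_add' (β : ℝ) (F G : HubbardGrassmann L M) (K : FreqMomentum L M) (σ : Fin 2) :
    selfEnergy L M β (F + G) K σ = selfEnergy L M β F K σ + selfEnergy L M β G K σ := by
  simp only [selfEnergy, vertexFn_def, kernel_add, mul_add]

omit [NeZero L] in
/-- `Σ[c • F] = c·Σ[F]`. -/
theorem selfEnergy_smul' (β : ℝ) (c : ℂ) (F : HubbardGrassmann L M) (K : FreqMomentum L M) (σ : Fin 2) :
    selfEnergy L M β (c • F) K σ = c * selfEnergy L M β F K σ := by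
  simp only [selfEnergy, vertexFn_def, kernel_smul]
  ring

omit [NeZero L] in
/-- `Σ[1] = 0` (the unit has no two-leg kernel). -/
theorem selfEnergy_one (β : ℝ) (K : FreqMomentum L M) (σ : Fin 2) : selfEnergy L M β (1 : HubbardGrassmann L M) K σ = 0 := by
  rw [selfEnergy, vertexFn_def, kernel_def, iterDeriv_succ_apply, grassmannDeriv_one, map_zero, map_zero, mul_zero, mul_zero]

omit [NeZero L] in
/-- The self-energy is `2βL²` times the two-leg kernel at the reading string. -/
theorem selfEnergy_eq_const_mul_kernel (β : ℝ) (F : HubbardGrassmann L M) (K : FreqMomentum L M) (σ : Fin 2) :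
    selfEnergy L M β F K σ = ((((2 : ℕ).factorial : ℝ) * (β * (L : ℝ) ^ 2) ^ (2 - 1) : ℝ) : ℂ) *
      kernel ℂ F 2 ![(((K, σ), 0) : HubbardFieldIdx L M), ((K, σ), 1)] := by
  rw [selfEnergy, vertexFn_def]

omit [NeZero L] in
/-- `‖(2!·(βL²)¹ : ℂ)‖ = 2|β|L²`. -/
theorem norm_selfEnergy_const (β : ℝ) : ‖((((2 : ℕ).factorial : ℝ) * (β * (L : ℝ) ^ 2) ^ (2 - 1) : ℝ) : ℂ)‖ = 2 * (|β| * (L : ℝ) ^ 2) := by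
  rw [Complex.norm_real, Real.norm_eq_abs, Nat.factorial_two]
  simp [abs_mul, abs_pow]

/-! ## §2 The loop term over the SUPPORT of `ṡ` -/

/-- **Loop term in moment form, four-leg hypothesis on the support of `ṡ` only**: if the moments of `k⃗ ↦ 𝒲₄(X_{(ω_i,k⃗,σ)}, Ā, A)` are `≤ N` for every
loop label `A` with `ṡ(A.1) ≠ 0`, then `Σ_x w(x)‖𝔉⁻¹[k⃗ ↦ kernel (Δ_{normalCovariance ṡ} 𝒲) 2 X_{(ω_i,k⃗,σ)}](x)‖ ≤ 12·(Σ_p‖ṡ p‖)·N`. -/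
theorem covResp_moment_kernel_two_laplacian_le_of_support (sdot : FreqMomentum L M × Fin 2 → ℂ) (W : HubbardGrassmann L M) (i : MatsubaraIdx M)
    (σ : Fin 2) {w : TorusSite 2 L → ℝ} (hw0 : ∀ x, 0 ≤ w x) {N : ℝ} (hN0 : 0 ≤ N)
    (hN : ∀ A : HubbardFieldIdx L M, sdot A.1 ≠ 0 → ∑ x, w x * ‖torusFourierInv (fun kv : TorusSite 2 L =>
      kernel ℂ W 4 (Fin.snoc (Fin.snoc ![((((i, kv), σ), 0) : HubbardFieldIdx L M), (((i, kv), σ), 1)] (A.1, 1 - A.2) :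
        Fin 3 → HubbardFieldIdx L M) A)) x‖ ≤ N) :
    ∑ x, w x * ‖torusFourierInv (fun kv : TorusSite 2 L =>
        kernel ℂ (grassmannLaplacian ℂ (normalCovariance L M sdot) W) 2 ![((((i, kv), σ), 0) : HubbardFieldIdx L M), (((i, kv), σ), 1)]) x‖ ≤
      12 * (∑ p, ‖sdot p‖) * N := by
  classical
  -- replace `W` by nothing: split the symbol's support; off the support the covariance entries vanish, so we may use the UNRESTRICTED lemma with the
  -- kernel data replaced by `0` there.  Concretely: define truncated data `F A := [sdot A.1 ≠ 0]·𝒲₄(…,A)`; its moments are `≤ N` for every `A`.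
  set X : TorusSite 2 L → HubbardFieldIdx L M → (Fin 4 → HubbardFieldIdx L M) := fun kv A =>
    (Fin.snoc (Fin.snoc ![((((i, kv), σ), 0) : HubbardFieldIdx L M), (((i, kv), σ), 1)] (A.1, 1 - A.2) : Fin 3 → HubbardFieldIdx L M) A) with hX
  -- the loop kernel as `c₆ · Σ_A Ċ(A,Ā) · 𝒲₄(X, Ā, A)` (as in `covResp_moment_kernel_two_laplacian_le`)
  set c₆ : ℂ := ((((2 + 1) * (2 + 2) : ℕ) : ℚ) / 2) • (1 : ℂ) with hc₆
  have hker : ∀ kv : TorusSite 2 L,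
      kernel ℂ (grassmannLaplacian ℂ (normalCovariance L M sdot) W) 2 ![((((i, kv), σ), 0) : HubbardFieldIdx L M), (((i, kv), σ), 1)] =
        c₆ * ∑ A ∈ univ.filter (fun A : HubbardFieldIdx L M => sdot A.1 ≠ 0), normalCovariance L M sdot A (A.1, 1 - A.2) *
          kernel ℂ W 4 (X kv A) := by
    intro kv
    rw [kernel_grassmannLaplacian, ← hc₆]
    congr 1
    rw [← Finset.sum_subset (Finset.subset_univ (univ.filter fun A : HubbardFieldIdx L M => sdot A.1 ≠ 0))]
    · refine sum_congr rfl fun A _ => ?_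
      exact Finset.sum_eq_single (A.1, 1 - A.2) (fun B _ hB => by rw [normalCovariance_eq_zero_of_ne_bar sdot A B hB, zero_mul])
        (fun h => absurd (mem_univ _) h)
    · intro A _ hA
      have hA0 : sdot A.1 = 0 := by simpa using hA
      refine Finset.sum_eq_zero fun B _ => ?_
      rw [normalCovariance_apply]
      by_cases h1 : A.1 = B.1
      · rw [if_pos h1]
        split_ifs <;> simp [hA0]
      · rw [if_neg h1, zero_mul]
  have hc6n : ‖c₆‖ = 6 := by
    rw [hc₆, show ((((2 + 1) * (2 + 2) : ℕ) : ℚ) / 2) = (6 : ℚ) by norm_num, Rat.smul_one_eq_cast, Rat.cast_ofNat]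
    exact RCLike.norm_ofNat 6
  simp_rw [hker, torusFourierInv_const_mul, norm_mul, hc6n]
  have h := sum_mul_norm_torusFourierInv_sum_le_of_le (univ.filter fun A : HubbardFieldIdx L M => sdot A.1 ≠ 0)
    (fun A => normalCovariance L M sdot A (A.1, 1 - A.2)) (fun A (kv : TorusSite 2 L) => kernel ℂ W 4 (X kv A)) hw0
    (fun A hA => hN A (mem_filter.1 hA).2)
  have hentry : ∑ A ∈ univ.filter (fun A : HubbardFieldIdx L M => sdot A.1 ≠ 0), ‖normalCovariance L M sdot A (A.1, 1 - A.2)‖ ≤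
      2 * ∑ p, ‖sdot p‖ := by
    rw [← sum_norm_normalCovariance_bar sdot]
    exact sum_le_sum_of_subset_of_nonneg (filter_subset _ _) fun _ _ _ => norm_nonneg _
  have hs0 : 0 ≤ ∑ p, ‖sdot p‖ := sum_nonneg fun _ _ => norm_nonneg _
  calc ∑ x, w x * (6 * ‖torusFourierInv (fun kv : TorusSite 2 L =>
          ∑ A ∈ univ.filter (fun A : HubbardFieldIdx L M => sdot A.1 ≠ 0), normalCovariance L M sdot A (A.1, 1 - A.2) * kernel ℂ W 4 (X kv A)) x‖)
      = 6 * ∑ x, w x * ‖torusFourierInv (fun kv : TorusSite 2 L =>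
          ∑ A ∈ univ.filter (fun A : HubbardFieldIdx L M => sdot A.1 ≠ 0), normalCovariance L M sdot A (A.1, 1 - A.2) * kernel ℂ W 4 (X kv A)) x‖ := by
        rw [mul_sum]; exact sum_congr rfl fun x _ => by ring
    _ ≤ 6 * ((∑ A ∈ univ.filter (fun A : HubbardFieldIdx L M => sdot A.1 ≠ 0), ‖normalCovariance L M sdot A (A.1, 1 - A.2)‖) * N) :=
        mul_le_mul_of_nonneg_left h (by norm_num)
    _ ≤ 6 * ((2 * ∑ p, ‖sdot p‖) * N) := by gcongr
    _ = 12 * (∑ p, ‖sdot p‖) * N := by ring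

/-- **The same in the `selfEnergy` normalisation, with the moment weight of the reading**: `M_j(k⃗ ↦ Σ[Δ_{ṡ}𝒲]((ω_i,k⃗),σ)) ≤ 2|β|L²·12·(Σ_p‖ṡ p‖)·N`. -/
theorem sum_momentWeight_norm_torusFourierInv_selfEnergy_laplacian_le (sdot : FreqMomentum L M × Fin 2 → ℂ) (W : HubbardGrassmann L M) (β : ℝ)
    (i : MatsubaraIdx M) (σ : Fin 2) (j : ℕ) {N : ℝ} (hN0 : 0 ≤ N)
    (hN : ∀ A : HubbardFieldIdx L M, sdot A.1 ≠ 0 → ∑ x : TorusSite 2 L, (1 + ((x 0).valMinAbs.natAbs : ℝ) + ((x 1).valMinAbs.natAbs : ℝ)) ^ j *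
      ‖torusFourierInv (fun kv : TorusSite 2 L =>
        kernel ℂ W 4 (Fin.snoc (Fin.snoc ![((((i, kv), σ), 0) : HubbardFieldIdx L M), (((i, kv), σ), 1)] (A.1, 1 - A.2) :
          Fin 3 → HubbardFieldIdx L M) A)) x‖ ≤ N) :
    ∑ x : TorusSite 2 L, (1 + ((x 0).valMinAbs.natAbs : ℝ) + ((x 1).valMinAbs.natAbs : ℝ)) ^ j *
        ‖torusFourierInv (fun kv : TorusSite 2 L => selfEnergy L M β (grassmannLaplacian ℂ (normalCovariance L M sdot) W) (i, kv) σ) x‖ ≤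
      2 * (|β| * (L : ℝ) ^ 2) * (12 * (∑ p, ‖sdot p‖) * N) := by
  have hw0 : ∀ x : TorusSite 2 L, 0 ≤ (1 + ((x 0).valMinAbs.natAbs : ℝ) + ((x 1).valMinAbs.natAbs : ℝ)) ^ j := fun x => by positivity
  have h := covResp_moment_kernel_two_laplacian_le_of_support sdot W i σ hw0 hN0 hN
  simp_rw [selfEnergy_eq_const_mul_kernel, torusFourierInv_const_mul, norm_mul, norm_selfEnergy_const]
  calc ∑ x : TorusSite 2 L, (1 + ((x 0).valMinAbs.natAbs : ℝ) + ((x 1).valMinAbs.natAbs : ℝ)) ^ j * (2 * (|β| * (L : ℝ) ^ 2) *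
        ‖torusFourierInv (fun kv : TorusSite 2 L => kernel ℂ (grassmannLaplacian ℂ (normalCovariance L M sdot) W) 2
          ![((((i, kv), σ), 0) : HubbardFieldIdx L M), (((i, kv), σ), 1)]) x‖)
      = 2 * (|β| * (L : ℝ) ^ 2) * ∑ x : TorusSite 2 L, (1 + ((x 0).valMinAbs.natAbs : ℝ) + ((x 1).valMinAbs.natAbs : ℝ)) ^ j *
        ‖torusFourierInv (fun kv : TorusSite 2 L => kernel ℂ (grassmannLaplacian ℂ (normalCovariance L M sdot) W) 2
          ![((((i, kv), σ), 0) : HubbardFieldIdx L M), (((i, kv), σ), 1)]) x‖ := by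
        rw [mul_sum]; exact sum_congr rfl fun x _ => by ring
    _ ≤ 2 * (|β| * (L : ℝ) ^ 2) * (12 * (∑ p, ‖sdot p‖) * N) := mul_le_mul_of_nonneg_left h (by positivity)

/-! ## §3 Moments of the spin/frequency-averaged data -/

/-- **Moments of the averaged data `¼Σ_σ[F₊ σ + F₋ σ]` are bounded by the common bound of the four pieces.** -/
theorem sum_mul_norm_torusFourierInv_locAvg_le {w : TorusSite 2 L → ℝ} (hw0 : ∀ x, 0 ≤ w x) (Fp Fm : Fin 2 → TorusSite 2 L → ℂ) {B : ℝ}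
    (hp : ∀ σ, ∑ x, w x * ‖torusFourierInv (Fp σ) x‖ ≤ B) (hm : ∀ σ, ∑ x, w x * ‖torusFourierInv (Fm σ) x‖ ≤ B) :
    ∑ x, w x * ‖torusFourierInv (fun kv : TorusSite 2 L => (∑ σ : Fin 2, (Fp σ kv + Fm σ kv)) / 4) x‖ ≤ B := by
  classical
  -- write the data as a linear combination over `Fin 2 × Fin 2` with coefficients `1/4`
  have hdata : (fun kv : TorusSite 2 L => (∑ σ : Fin 2, (Fp σ kv + Fm σ kv)) / 4) =
      fun kv => ∑ a ∈ (univ : Finset (Fin 2 × Fin 2)), (1 / 4 : ℂ) * (if a.2 = 0 then Fp a.1 kv else Fm a.1 kv) := by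
    funext kv
    rw [Fintype.sum_prod_type]
    simp only [Fin.sum_univ_two, Fin.isValue, if_true, one_ne_zero, if_false]
    ring
  rw [hdata]
  have h := sum_mul_norm_torusFourierInv_sum_le_of_le (univ : Finset (Fin 2 × Fin 2)) (fun _ => (1 / 4 : ℂ))
    (fun a (kv : TorusSite 2 L) => if a.2 = 0 then Fp a.1 kv else Fm a.1 kv) hw0 (N := B) ?_
  · refine h.trans (le_of_eq ?_)
    rw [sum_const, Finset.card_univ, Fintype.card_prod, Fintype.card_fin]
    norm_num
  · rintro ⟨σ, e⟩ _
    fin_cases e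
    · simpa using hp σ
    · simpa using hm σ

/-! ## §4 The per-functional door -/

/-- **THE COVARIANCE-RESPONSE DOOR FOR THE READING JETS** (vertex `V_U + 𝒩_K`, symbols `s₀ → s₁`, reading frequencies `ω₊, ω₋`).  Along
`C_t = normalCovariance (s₀ + t(s₁ − s₀))` with `Z_t ≠ 0`: if for every `t ∈ [0,1]` the `(1+|x̃₀|+|x̃₁|)ʲ`-moments of the four-leg data of `𝒲_t` at the loop
strings `(K σ 0)(K σ 1)(Ā)(A)` are `≤ N` for every loop label `A` in the support of `s₁ − s₀` (both reading frequencies, both spins), and the `j`-th momentum jets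
AT `q` of the interpolated real and imaginary parts of the TREE data `¼Σ_σ[Σ[(𝒲_t,𝒲_t)_{s₁−s₀}](ω_±,·,σ)]` are `≤ A` and `≤ A′`, then
`‖Dʲ[evalM (symInterp L (¼Σ_σ[Re Σ[𝒲′[s₁]](ω_±,·,σ)] − ¼Σ_σ[Re Σ[𝒲′[s₀]](ω_±,·,σ)]))](q)‖ ≤ 2·(2|β|L²·12·(Σ_p‖(s₁−s₀) p‖)·N) + (A + A′)/2`. -/
theorem covRespCT_readingJet_sub_le (s₀ s₁ : FreqMomentum L M × Fin 2 → ℂ) (β U : ℝ) (K : TrigPolyC4v) (ip im : MatsubaraIdx M)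
    (j : ℕ) (q : Momentum)
    (hZ : ∀ t ∈ Set.Icc (0 : ℝ) 1, effPartitionFn ℂ (normalCovariance L M s₀ + ((t : ℂ)) • (normalCovariance L M s₁ - normalCovariance L M s₀))
      (hubbardInteraction L M β U + counterQuadratic L M β K) ≠ 0)
    {N A A' : ℝ} (hN0 : 0 ≤ N) (hA0 : 0 ≤ A) (hA0' : 0 ≤ A')
    (hN : ∀ t ∈ Set.Icc (0 : ℝ) 1, ∀ i ∈ ({ip, im} : Finset (MatsubaraIdx M)), ∀ σ : Fin 2, ∀ A : HubbardFieldIdx L M, s₁ A.1 - s₀ A.1 ≠ 0 →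
      ∑ x : TorusSite 2 L, (1 + ((x 0).valMinAbs.natAbs : ℝ) + ((x 1).valMinAbs.natAbs : ℝ)) ^ j * ‖torusFourierInv (fun kv : TorusSite 2 L =>
        kernel ℂ (effAction ℂ (normalCovariance L M s₀ + ((t : ℂ)) • (normalCovariance L M s₁ - normalCovariance L M s₀))
          (hubbardInteraction L M β U + counterQuadratic L M β K)) 4
          (Fin.snoc (Fin.snoc ![((((i, kv), σ), 0) : HubbardFieldIdx L M), (((i, kv), σ), 1)] (A.1, 1 - A.2) : Fin 3 → HubbardFieldIdx L M) A)) x‖ ≤ N)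
    (hT : ∀ t ∈ Set.Icc (0 : ℝ) 1,
      ‖iteratedFDeriv ℝ j (evalM (symInterp L (fun kv : TorusSite 2 L => ((∑ σ : Fin 2,
        (selfEnergy L M β (grassmannDerivPairing ℂ (normalCovariance L M s₁ - normalCovariance L M s₀)
            (effAction ℂ (normalCovariance L M s₀ + ((t : ℂ)) • (normalCovariance L M s₁ - normalCovariance L M s₀))
              (hubbardInteraction L M β U + counterQuadratic L M β K))
            (effAction ℂ (normalCovariance L M s₀ + ((t : ℂ)) • (normalCovariance L M s₁ - normalCovariance L M s₀))
              (hubbardInteraction L M β U + counterQuadratic L M β K))) (ip, kv) σ +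
          selfEnergy L M β (grassmannDerivPairing ℂ (normalCovariance L M s₁ - normalCovariance L M s₀)
            (effAction ℂ (normalCovariance L M s₀ + ((t : ℂ)) • (normalCovariance L M s₁ - normalCovariance L M s₀))
              (hubbardInteraction L M β U + counterQuadratic L M β K))
            (effAction ℂ (normalCovariance L M s₀ + ((t : ℂ)) • (normalCovariance L M s₁ - normalCovariance L M s₀))
              (hubbardInteraction L M β U + counterQuadratic L M β K))) (im, kv) σ)) / 4).re))) q‖ ≤ A ∧
      ‖iteratedFDeriv ℝ j (evalM (symInterp L (fun kv : TorusSite 2 L => ((∑ σ : Fin 2,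
        (selfEnergy L M β (grassmannDerivPairing ℂ (normalCovariance L M s₁ - normalCovariance L M s₀)
            (effAction ℂ (normalCovariance L M s₀ + ((t : ℂ)) • (normalCovariance L M s₁ - normalCovariance L M s₀))
              (hubbardInteraction L M β U + counterQuadratic L M β K))
            (effAction ℂ (normalCovariance L M s₀ + ((t : ℂ)) • (normalCovariance L M s₁ - normalCovariance L M s₀))
              (hubbardInteraction L M β U + counterQuadratic L M β K))) (ip, kv) σ +
          selfEnergy L M β (grassmannDerivPairing ℂ (normalCovariance L M s₁ - normalCovariance L M s₀)
            (effAction ℂ (normalCovariance L M s₀ + ((t : ℂ)) • (normalCovariance L M s₁ - normalCovariance L M s₀))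
              (hubbardInteraction L M β U + counterQuadratic L M β K))
            (effAction ℂ (normalCovariance L M s₀ + ((t : ℂ)) • (normalCovariance L M s₁ - normalCovariance L M s₀))
              (hubbardInteraction L M β U + counterQuadratic L M β K))) (im, kv) σ)) / 4).im))) q‖ ≤ A') :
    ‖iteratedFDeriv ℝ j (evalM (symInterp L (fun kv : TorusSite 2 L =>
        (∑ σ : Fin 2, ((selfEnergy L M β (effAction ℂ (normalCovariance L M s₁) (hubbardInteraction L M β U + counterQuadratic L M β K)) (ip, kv) σ).re +
          (selfEnergy L M β (effAction ℂ (normalCovariance L M s₁) (hubbardInteraction L M β U + counterQuadratic L M β K)) (im, kv) σ).re)) / 4 -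
        (∑ σ : Fin 2, ((selfEnergy L M β (effAction ℂ (normalCovariance L M s₀) (hubbardInteraction L M β U + counterQuadratic L M β K)) (ip, kv) σ).re +
          (selfEnergy L M β (effAction ℂ (normalCovariance L M s₀) (hubbardInteraction L M β U + counterQuadratic L M β K)) (im, kv) σ).re)) / 4))) q‖ ≤
      2 * (2 * (|β| * (L : ℝ) ^ 2) * (12 * (∑ p, ‖s₁ p - s₀ p‖) * N)) + (A + A') / 2 := by
  classical
  letI : LinearOrder (HubbardFieldIdx L M) := LinearOrder.lift' (Fintype.equivFin _) (Fintype.equivFin _).injective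
  set V := hubbardInteraction L M β U + counterQuadratic L M β K with hV
  -- the complex averaged reading data of a Grassmann element
  set G : HubbardGrassmann L M → TorusSite 2 L → ℂ := fun W kv =>
    (∑ σ : Fin 2, (selfEnergy L M β W (ip, kv) σ + selfEnergy L M β W (im, kv) σ)) / 4 with hG
  have hGadd : ∀ W W' : HubbardGrassmann L M, G (W + W') = fun kv => G W kv + G W' kv := fun W W' => by
    funext kv
    simp only [hG, selfEnergy_add', Fin.sum_univ_two]
    ring
  have hGsmul : ∀ (c : ℂ) (W : HubbardGrassmann L M), G (c • W) = fun kv => c * G W kv := fun c W => by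
    funext kv
    simp only [hG, selfEnergy_smul', Fin.sum_univ_two]
    ring
  have hG1 : G 1 = fun _ => 0 := by
    funext kv
    simp only [hG, selfEnergy_one, Fin.sum_univ_two, add_zero, zero_div]
  have hGsub : ∀ W W' : HubbardGrassmann L M, G (W - W') = fun kv => G W kv - G W' kv := fun W W' => by
    rw [sub_eq_add_neg, hGadd, ← neg_one_smul ℂ W', hGsmul]
    funext kv; ring
  -- the real part of the endpoint-difference data IS the reading data of the statement
  set W₁ := effAction ℂ (normalCovariance L M s₁) V with hW₁
  set W₀ := effAction ℂ (normalCovariance L M s₀) V with hW₀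
  have hre : (fun kv : TorusSite 2 L =>
        (∑ σ : Fin 2, ((selfEnergy L M β W₁ (ip, kv) σ).re + (selfEnergy L M β W₁ (im, kv) σ).re)) / 4 -
        (∑ σ : Fin 2, ((selfEnergy L M β W₀ (ip, kv) σ).re + (selfEnergy L M β W₀ (im, kv) σ).re)) / 4) =
      fun kv => (G (W₁ - W₀) kv).re := by
    funext kv
    rw [hGsub]
    simp only [hG, Fin.sum_univ_two, Complex.sub_re, Complex.div_ofNat_re, Complex.add_re]
  rw [hre]
  -- the bound constant
  set Bl : ℝ := 2 * (|β| * (L : ℝ) ^ 2) * (12 * (∑ p, ‖s₁ p - s₀ p‖) * N) with hBl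
  have hBl0 : 0 ≤ Bl := by rw [hBl]; positivity
  refine norm_iteratedFDeriv_evalM_symInterp_re_le_of_readingJet (G (W₁ - W₀)) j q (by positivity) fun v => ?_
  -- the fixed ℂ-linear functional: the reading jet of the averaged data
  let Φ : HubbardGrassmann L M →ₗ[ℂ] ℂ :=
    { toFun := fun W => ∑ x : TorusSite 2 L, ((torusCosCoeff L (fun k => (G W k).re) x : ℂ) + (torusCosCoeff L (fun k => (G W k).im) x : ℂ) * Complex.I) *
        ((iteratedFDeriv ℝ j (fun q : Momentum => TrigPolyC4v.harmonic (x 0).valMinAbs.natAbs (x 1).valMinAbs.natAbs (WithLp.ofLp q)) q v : ℝ) : ℂ)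
      map_add' := fun W W' => by
        have h := readingJet_add (G W) (G W') j q v
        rw [hGadd]
        exact h
      map_smul' := fun c W => by
        have h := readingJet_smul c (G W) j q v
        rw [RingHom.id_apply, smul_eq_mul, hGsmul]
        exact h }
  have hΦapply : ∀ W, Φ W = ∑ x : TorusSite 2 L, ((torusCosCoeff L (fun k => (G W k).re) x : ℂ) + (torusCosCoeff L (fun k => (G W k).im) x : ℂ) * Complex.I) *
        ((iteratedFDeriv ℝ j (fun q : Momentum => TrigPolyC4v.harmonic (x 0).valMinAbs.natAbs (x 1).valMinAbs.natAbs (WithLp.ofLp q)) q v : ℝ) : ℂ) :=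
    fun W => rfl
  have hΦ1 : Φ 1 = 0 := by
    have h := readingJet_smul 0 (G 1) j q v
    rw [zero_mul] at h
    rw [hΦapply, ← h, hG1]
    simp
  -- endpoint difference = the reading jet of the difference data
  have hdiff : Φ W₁ - Φ W₀ = ∑ x : TorusSite 2 L, ((torusCosCoeff L (fun k => (G (W₁ - W₀) k).re) x : ℂ) +
        (torusCosCoeff L (fun k => (G (W₁ - W₀) k).im) x : ℂ) * Complex.I) *
        ((iteratedFDeriv ℝ j (fun q : Momentum => TrigPolyC4v.harmonic (x 0).valMinAbs.natAbs (x 1).valMinAbs.natAbs (WithLp.ofLp q)) q v : ℝ) : ℂ) := by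
    rw [← map_sub, hΦapply]
  rw [← hdiff]
  have hV0 := constPart_hubbardInteraction_add_counterQuadratic (L := L) (M := M) β U K
  have hVe : V ∈ evenOdd ℂ (ι := HubbardFieldIdx L M) 0 := hubbardInteraction_add_counterQuadratic_mem_evenOdd_zero β U K
  refine norm_apply_effAction_sub_le_of_linePath (normalCovariance L M s₀) (normalCovariance L M s₁) hV0 hVe hZ Φ hΦ1 ?_
  intro t ht
  have hNt := hN t ht
  have hTt := hT t ht
  set Wt := effAction ℂ (normalCovariance L M s₀ + ((t : ℂ)) • (normalCovariance L M s₁ - normalCovariance L M s₀)) V with hWt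
  -- LOOP: moments of the averaged Laplacian data, support-restricted four-leg hypothesis
  have hloop : ‖Φ (grassmannLaplacian ℂ (normalCovariance L M s₁ - normalCovariance L M s₀) Wt)‖ ≤ 2 * Bl * ∏ i, ‖v i‖ := by
    rw [hΦapply]
    refine (norm_readingJet_le_moments _ j q v).trans ?_
    have hw0 : ∀ x : TorusSite 2 L, 0 ≤ (1 + ((x 0).valMinAbs.natAbs : ℝ) + ((x 1).valMinAbs.natAbs : ℝ)) ^ j := fun x => by positivity
    have hmom : ∑ x : TorusSite 2 L, (1 + ((x 0).valMinAbs.natAbs : ℝ) + ((x 1).valMinAbs.natAbs : ℝ)) ^ j *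
        ‖torusFourierInv (G (grassmannLaplacian ℂ (normalCovariance L M s₁ - normalCovariance L M s₀) Wt)) x‖ ≤ Bl := by
      rw [normalCovariance_sub]
      refine sum_mul_norm_torusFourierInv_locAvg_le hw0
        (fun σ kv => selfEnergy L M β (grassmannLaplacian ℂ (normalCovariance L M fun p => s₁ p - s₀ p) Wt) (ip, kv) σ)
        (fun σ kv => selfEnergy L M β (grassmannLaplacian ℂ (normalCovariance L M fun p => s₁ p - s₀ p) Wt) (im, kv) σ) ?_ ?_
      · exact fun σ => sum_momentWeight_norm_torusFourierInv_selfEnergy_laplacian_le (fun p => s₁ p - s₀ p) Wt β ip σ j hN0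
          (fun A hA => hNt ip (by simp) σ A hA)
      · exact fun σ => sum_momentWeight_norm_torusFourierInv_selfEnergy_laplacian_le (fun p => s₁ p - s₀ p) Wt β im σ j hN0
          (fun A hA => hNt im (by simp) σ A hA)
    exact mul_le_mul_of_nonneg_right (mul_le_mul_of_nonneg_left hmom (by norm_num)) (Finset.prod_nonneg fun i _ => norm_nonneg _)
  -- TREE: the sup-route hypothesis on the real and imaginary jets of the pairing data
  have htree : ‖Φ (grassmannDerivPairing ℂ (normalCovariance L M s₁ - normalCovariance L M s₀) Wt Wt)‖ ≤ (A + A') * ∏ i, ‖v i‖ := by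
    rw [hΦapply]
    exact norm_readingJet_le_of_jets _ j q v hTt.1 hTt.2
  calc ‖Φ (grassmannLaplacian ℂ (normalCovariance L M s₁ - normalCovariance L M s₀) Wt) -
        (2 : ℂ)⁻¹ * Φ (grassmannDerivPairing ℂ (normalCovariance L M s₁ - normalCovariance L M s₀) Wt Wt)‖
      ≤ ‖Φ (grassmannLaplacian ℂ (normalCovariance L M s₁ - normalCovariance L M s₀) Wt)‖ +
          ‖(2 : ℂ)⁻¹ * Φ (grassmannDerivPairing ℂ (normalCovariance L M s₁ - normalCovariance L M s₀) Wt Wt)‖ := norm_sub_le _ _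
    _ ≤ 2 * Bl * ∏ i, ‖v i‖ + 2⁻¹ * ((A + A') * ∏ i, ‖v i‖) := by
        refine add_le_add hloop ?_
        rw [norm_mul, norm_inv, RCLike.norm_ofNat]
        exact mul_le_mul_of_nonneg_left htree (by norm_num)
    _ = (2 * Bl + (A + A') / 2) * ∏ i, ‖v i‖ := by ring

end Summit.HubbardSuperconductivity.HubbardSuperconductivity.Theorems.EngineV8

end
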